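import Summits.BirchSwinnertonDyer.BirchSwinnertonDyer.Theorems.ErratumRoadFiveIMCDivAtomsB
import HarnessLib

/-!
# Route `ErratumRoadFive` (rung K2, `p ≥ 5`), crux `Rest3NoWitnessBranchAtFive` (item stmt-BirchSwinnertonDyer-19703):
# the re-oriented (2.4)♭ᴮ atoms on the «RAM-FREE» erratum data — DEFINITIONS + the forgetful bridge

Cell `bsd-stepL` (run/shared/lean/pub/bsd-stepL/), seat `bsd-stepL-imc-p1` (prover g32, 2026-08-29); `--supports
stmt-BirchSwinnertonDyer-19703 --as helper`; Theses-free (imports only imc24b's Theses-free `ErratumRoadFiveIMCDivAtomsB`).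
This is the shape half of step K4 of `HOME/imc-p1/g26/RAMFREE-REKEY-PROPOSAL.md` (planner RULING 86 (c): «recorded, not
applied» for the ROUTE; the helper theorems over these shapes are a partial result on the OPEN crux 19703 and change no
item, no statement and no registry).

WHY. The landed atoms `P2.IMCDivIntFrameAtErratumDataB W p` ∕ `P2.IMCDivIntCoreFrameAtErratumDataB W p` quantify over the
ERRATUM DATA of `(W, p)`: their binders open with `ErratumHypotheses W p →` (= `5 ≤ p ∧ Mult W p ∧ Irr W p ∧
X11.AprimeLocusAt W p`, the last clause being «a NON-SPLIT multiplicative `q′ ≠ p` with `E[p]` RAMIFIED at `q′`, and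
`E(ℚ_p)[p] = 0`») and carry, for the datum's `q`, the binder `¬ p ∣ padicValInt q W.minimalDiscriminantInt →` («`E[p]`
ramified at `q`»). On a pair of crux 19703's NEW_A rows (census j319451: 7 548 pairs with `N < 5·10⁵` — `Ram W p` by
another prime, an ODD NON-SPLIT multiplicative `q ≠ p` with `p ∣ v_q(Δ_min)`, `E(ℚ_p)[p] = 0`) both clauses FAIL, so the
landed shapes are vacuous there. Yet every step of the kernel uses the ramification of `E[p]` at `q` in exactly two
places, both replaceable: `ρ̄_{E,p}` onto (`surj_of_irr_of_ram` — ANY (ram) prime does) and (TAM-q) `p ∤ c_w(E/K)` for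
`w ∣ q` (for NON-SPLIT `q` the Tamagawa numbers at `q`, at `w` and for the twist lie in `{1, 2, 4}` — g26's (U4)
`RamFree.tamagawaDescentAt_of_isErratumField_nonsplit`, p675810). The open input itself ([FW21 Thm. 4.41] as typed
print-faithfully, F4♯‡ p675866: (i) `ρ̄_g|_{G_K}` irreducible, (iii) some `q ∥ M` non-split in `K`) never asked for it.

## What this file declares (two `@[conjecture]` shapes with bodies; nothing asserted) and proves

* **`P2.IMCDivIntFrameAtErratumDataBRamFree W p`**, **`P2.IMCDivIntCoreFrameAtErratumDataBRamFree W p`** — the bodies of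
  `P2.IMCDivIntFrameAtErratumDataB` ∕ `P2.IMCDivIntCoreFrameAtErratumDataB` VERBATIM except: the binder
  `ErratumHypotheses W p →` is replaced by `5 ≤ p → Mult W p → Surj W p →
  (∀ P₀ : (W.baseChange ℚ_[p]).toAffine.Point, p • P₀ = 0 → P₀ = 0) →`, and the binder
  `¬ p ∣ padicValInt q W.minimalDiscriminantInt →` is DELETED. Frame, value conjunct, X-slot (`𝔭bar ≠ 𝔭_{ι′}`) and every
  other print-facing binder are unchanged.
* the forgetful bridge (value ↦ core) and the specialisation «ram-free shape ⟹ landed shape» (on the A′-locus the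
  ram-free binders are met: `Surj` from `Irr` + the locus's witness), so nothing proved over the landed shapes is lost.

HONEST FRAMING: definitions with bodies (open shapes, `[claim: Castella2018Erratum, status: under-review]`) and bookkeeping
theorems; no named fact, no instance, no notation, no `sorry`; nothing is booked; BSD is proved for no pair; the
anticyclotomic main conjecture is asserted nowhere.

References: [Castella2018] Thm. 3.1, display (3.2), Thm. 3.2 (arXiv:1704.06608 p. 9); [Castella2018Erratum] (2.4), Thm. 1.1
(pp. 1, 4); [CastellaGrossiLeeSkinner2022] Thm. 5.1.1; cell files `HOME/imc-p1/g26/RAMFREE-ROAD-imc-p1-g26.md`,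
`HOME/imc-p1/g26/RAMFREE-REKEY-PROPOSAL.md`.
-/

noncomputable section

open scoped Classical

open WeierstrassCurve NumberField IsDedekindDomain Field PowerSeries
open Literature.NumberTheory.EllipticCurves Literature.NumberTheory.EllipticCurves.GreenbergSelmer
open Literature.NumberTheory.EllipticCurves.ModularForms
open Literature.NumberTheory.EllipticCurves.Rank1Residual
open Literature.NumberTheory.EllipticCurves.Rank1Residual.Typed
open Literature.NumberTheory.EllipticCurves.Castella2018
open Literature.NumberTheory.GaloisRepresentations
open Literature.NumberTheory.GaloisCohomology
open Summit.BirchSwinnertonDyer.Rank1Residual.X11b.AcSelmer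
open Summit.BirchSwinnertonDyer.Rank1Residual.X11b.Halves

namespace Summit.BirchSwinnertonDyer.Rank1Residual.X11b

/-! ### §1 The ram-free re-oriented shapes -/

section Shape

variable (W : WeierstrassCurve ℚ) [W.IsElliptic] [W.IsGloballyMinimal] (p : ℕ) [Fact p.Prime]

/-- **(2.4)♭ ONE-SIDED, WITH VALUE, RE-ORIENTED, AT THE RAM-FREE ERRATUM DATA of `(W, p)`.** The body of
`P2.IMCDivIntFrameAtErratumDataB W p` VERBATIM except that `ErratumHypotheses W p →` is replaced by the four pair binders
`5 ≤ p → Mult W p → Surj W p → (E(ℚ_p)[p] = 0) →` and the datum binder `¬ p ∣ padicValInt q W.minimalDiscriminantInt →`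
(«`E[p]` ramified at `q`») is deleted: for every odd-or-not prime `q ≠ p` of NON-SPLIT multiplicative reduction, every
erratum field `K` for `q` meeting [Cas20 §2.5], every Manin-good datum and Heegner point of infinite order, every
anticyclotomic `(κ, γ)`, `ι′`, compatible `e`, and every X-slot `𝔭bar ∋ p` other than `𝔭_{ι′}`, THERE IS a ♭-frame
`(Ω_K ≠ 0, ‖Ω_p‖ = 1, Q)` at `(ι′, 𝔭_{ι′})` [Cas18 Thm. 3.1] with the value `Q(𝟙) = u·((1 − a_p p⁻¹)·log_ω P)²`
[Cas18 Thm. 3.2] and `Ch_Λ(X_ac(E[p^∞]; strict at 𝔭bar))·𝓞_{ℂ_p}⟦T⟧ ⊆ (Q)` [erratum (2.4) ⇐ [FW21, Thm. 4.41] + Hida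
descent — PREPRINT]. A predicate on `(W, p)`; NEVER a theorem in this cell; every result using it is CONDITIONAL.
[claim: Castella2018Erratum, status: under-review]
[cite: Castella2018, Thm. 3.1, display (3.2) and Thm. 3.2 (arXiv:1704.06608 p. 9) (shape only; nothing asserted)]
[cite: CastellaGrossiLeeSkinner2022, Thm. 5.1.1 (frame at `(ι_p, v)`, module strict at `v̄`; shape only)] -/
@[conjecture]
def P2.IMCDivIntFrameAtErratumDataBRamFree : Prop :=
  ∀ [NeZero (W.conductorNorm ℤ)] (q : ℕ) [Fact q.Prime] (K : Type) [Field K] [NumberField K]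
    (Dt : ModularParametrizationData W (W.conductorNorm ℤ))
    (H : HeegnerDatum (W.conductorNorm ℤ) (NumberField.discr K)) (w₀ : InfinitePlace K)
    (P : (W.baseChange K).toAffine.Point), 5 ≤ p → Mult W p → Surj W p →
    (∀ P₀ : (W.baseChange ℚ_[p]).toAffine.Point, p • P₀ = 0 → P₀ = 0) → W.analyticRank = 1 →
    q ≠ p → Mult W q → ¬ W.HasSplitMultiplicativeReductionAtPrime q → IsErratumField W K q →
    Cas20Standing K p (W.conductorNorm ℤ / p) →
    WeierstrassCurve.Affine.Point.map w₀.embedding.toRatAlgHom P = heegnerPointComplex Dt H →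
    ¬ (p : ℤ) ∣ Dt.c → ¬ IsOfFinAddOrder P →
    ∀ (κ : ZpExtension K p), κ.IsAnticyclotomic →
      ∀ (γ : Field.absoluteGaloisGroup K) [Fact (κ.IsTopGenerator γ)] (ι' : PadicAlgCl p ≃+* ℂ)
        (e : K →+* ℚ_[p]),
        (∀ k : 𝓞 K, k ∈ (primeOfEmbeddingDatum p ι' w₀.embedding).asIdeal ↔ ‖e (k : K)‖ < 1) →
        ∀ (𝔭bar : HeightOneSpectrum (𝓞 K)), ((p : ℕ) : 𝓞 K) ∈ 𝔭bar.asIdeal →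
          𝔭bar ≠ primeOfEmbeddingDatum p ι' w₀.embedding →
          ∃ (ΩK : ℂ) (Ωp : ℂ_[p]) (Q : PowerSeries 𝓞_ℂ_[p]), ΩK ≠ 0 ∧ ‖Ωp‖ = 1 ∧
            R1.IsBDPLFunctionInt p ι' (primeOfEmbeddingDatum p ι' w₀.embedding) κ γ Dt.f ΩK Ωp Q ∧
            R1.BDPValueAtOneIntAt W p e P Q (W.LFunction p) ∧
            (XAc.charIdeal (W.baseChange K) p κ 𝔭bar ∅ γ).map (PowerSeries.map (R1.toCpInt p)) ≤
              Ideal.span {Q}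

/-- **(2.4)♭ ONE-SIDED CORE (no value conjunct), RE-ORIENTED, AT THE RAM-FREE ERRATUM DATA of `(W, p)`.** The body
of `P2.IMCDivIntCoreFrameAtErratumDataB W p` VERBATIM with the same two binder edits as
`P2.IMCDivIntFrameAtErratumDataBRamFree` (`ErratumHypotheses W p` ↦ `5 ≤ p`, `Mult W p`, `Surj W p`, `E(ℚ_p)[p] = 0`;
`¬ p ∣ padicValInt q W.minimalDiscriminantInt` deleted). The currency in which Road FF (Σ-data + the Fitting-level
congruence frame from F4♯‡ + F3♯‡) delivers on the ram-free data. A predicate on `(W, p)`; NEVER a theorem in this cell.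
[claim: Castella2018Erratum, status: under-review]
[cite: Castella2018, Thm. 3.1 and display (3.2) (arXiv:1704.06608 p. 9) (shape only; nothing asserted)] -/
@[conjecture]
def P2.IMCDivIntCoreFrameAtErratumDataBRamFree : Prop :=
  ∀ [NeZero (W.conductorNorm ℤ)] (q : ℕ) [Fact q.Prime] (K : Type) [Field K] [NumberField K]
    (Dt : ModularParametrizationData W (W.conductorNorm ℤ))
    (H : HeegnerDatum (W.conductorNorm ℤ) (NumberField.discr K)) (w₀ : InfinitePlace K)
    (P : (W.baseChange K).toAffine.Point), 5 ≤ p → Mult W p → Surj W p →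
    (∀ P₀ : (W.baseChange ℚ_[p]).toAffine.Point, p • P₀ = 0 → P₀ = 0) → W.analyticRank = 1 →
    q ≠ p → Mult W q → ¬ W.HasSplitMultiplicativeReductionAtPrime q → IsErratumField W K q →
    Cas20Standing K p (W.conductorNorm ℤ / p) →
    WeierstrassCurve.Affine.Point.map w₀.embedding.toRatAlgHom P = heegnerPointComplex Dt H →
    ¬ (p : ℤ) ∣ Dt.c → ¬ IsOfFinAddOrder P →
    ∀ (κ : ZpExtension K p), κ.IsAnticyclotomic →
      ∀ (γ : Field.absoluteGaloisGroup K) [Fact (κ.IsTopGenerator γ)] (ι' : PadicAlgCl p ≃+* ℂ)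
        (e : K →+* ℚ_[p]),
        (∀ k : 𝓞 K, k ∈ (primeOfEmbeddingDatum p ι' w₀.embedding).asIdeal ↔ ‖e (k : K)‖ < 1) →
        ∀ (𝔭bar : HeightOneSpectrum (𝓞 K)), ((p : ℕ) : 𝓞 K) ∈ 𝔭bar.asIdeal →
          𝔭bar ≠ primeOfEmbeddingDatum p ι' w₀.embedding →
          ∃ (ΩK : ℂ) (Ωp : ℂ_[p]) (Q : PowerSeries 𝓞_ℂ_[p]), ΩK ≠ 0 ∧ ‖Ωp‖ = 1 ∧
            R1.IsBDPLFunctionInt p ι' (primeOfEmbeddingDatum p ι' w₀.embedding) κ γ Dt.f ΩK Ωp Q ∧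
            (XAc.charIdeal (W.baseChange K) p κ 𝔭bar ∅ γ).map (PowerSeries.map (R1.toCpInt p)) ≤
              Ideal.span {Q}

end Shape

/-! ### §2 Bridges -/

section Bridges

variable {W : WeierstrassCurve ℚ} [W.IsElliptic] [W.IsGloballyMinimal] {p : ℕ} [Fact p.Prime]

/-- Forget the value conjunct (ram-free data). [claim: Castella2018Erratum, status: under-review] -/
theorem P2.imcDivIntCoreFrameAtErratumDataBRamFree_of_frame
    (h : P2.IMCDivIntFrameAtErratumDataBRamFree W p) :
    P2.IMCDivIntCoreFrameAtErratumDataBRamFree W p := by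
  intro _ q _ K _ _ Dt H w₀ P hp5 hmult hsurj htors hr hqp hmq hns hK hCas hP hc hinf κ hκ γ _ ι' e he
    𝔭bar h𝔭bar hne
  obtain ⟨ΩK, Ωp, Q, hΩ, hΩp, hQ, -, h3At⟩ :=
    h q K Dt H w₀ P hp5 hmult hsurj htors hr hqp hmq hns hK hCas hP hc hinf κ hκ γ ι' e he 𝔭bar h𝔭bar hne
  exact ⟨ΩK, Ωp, Q, hΩ, hΩp, hQ, h3At⟩

/-- On the A′-hypotheses the ram-free pair binders hold: `5 ≤ p`, `Mult W p`, `Surj W p` (`Irr` + the locus's ramified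
witness, `surj_of_irr_of_ram`) and `E(ℚ_p)[p] = 0`. [cite: Serre1972, §2.4 Prop. 15] -/
theorem ErratumHypotheses.ramFreeBinders (hE : ErratumHypotheses W p) :
    5 ≤ p ∧ Mult W p ∧ Surj W p ∧ (∀ P₀ : (W.baseChange ℚ_[p]).toAffine.Point, p • P₀ = 0 → P₀ = 0) :=
  ⟨hE.1, hE.2.1, surj_of_irr_of_ram W p hE.2.2.1 (X11.ram_of_aprimeLocusAt hE.2.2.2), hE.2.2.2.2⟩

/-- **The ram-free CORE shape specialises to the landed one**: on the A′-locus the four pair binders are met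
(`ErratumHypotheses.ramFreeBinders`) and the ramification binder is simply not used — so every consumer of
`P2.IMCDivIntCoreFrameAtErratumDataB W p` (K2's `closes`, the rungs) is served by the ram-free shape as well.
[claim: Castella2018Erratum, status: under-review] -/
theorem P2.imcDivIntCoreFrameAtErratumDataB_of_ramFree
    (h : P2.IMCDivIntCoreFrameAtErratumDataBRamFree W p) :
    P2.IMCDivIntCoreFrameAtErratumDataB W p := by
  intro _ q _ K _ _ Dt H w₀ P hE hr hqp hmq hns _hvq hK hCas hP hc hinf κ hκ γ _ ι' e he 𝔭bar h𝔭bar hne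
  obtain ⟨hp5, hmult, hsurj, htors⟩ := hE.ramFreeBinders
  exact h q K Dt H w₀ P hp5 hmult hsurj htors hr hqp hmq hns hK hCas hP hc hinf κ hκ γ ι' e he 𝔭bar
    h𝔭bar hne

/-- **The ram-free shape WITH VALUE specialises to the landed one** (same bookkeeping).
[claim: Castella2018Erratum, status: under-review] -/
theorem P2.imcDivIntFrameAtErratumDataB_of_ramFree
    (h : P2.IMCDivIntFrameAtErratumDataBRamFree W p) :
    P2.IMCDivIntFrameAtErratumDataB W p := by
  intro _ q _ K _ _ Dt H w₀ P hE hr hqp hmq hns _hvq hK hCas hP hc hinf κ hκ γ _ ι' e he 𝔭bar h𝔭bar hne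
  obtain ⟨hp5, hmult, hsurj, htors⟩ := hE.ramFreeBinders
  exact h q K Dt H w₀ P hp5 hmult hsurj htors hr hqp hmq hns hK hCas hP hc hinf κ hκ γ ι' e he 𝔭bar
    h𝔭bar hne

end Bridges

end Summit.BirchSwinnertonDyer.Rank1Residual.X11b

end
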